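import Literature.NumberTheory.Transcendental.BrownMotivicCoactionCoassociative
import Literature.NumberTheory.Transcendental.DrinfeldAssociatorIsGroupLikeProofs
import HarnessLib

/-!
# Brown's period point `dch` and the comparison form of the motivic input

[Brown2012, §2.1 (2.2)]: "Let `dch ∈ ₀Π₁(ℝ)` denote the de Rham image of the straight line from
`0` to `1` ([DG], 5.16). It is a formal power series whose coefficients are multiple zeta values,
and is also known as the Drinfeld associator. It defines a function `dch : 𝒪(₀Π₁) → ℝ` which maps
a word `w` in `e⁰, e¹` to the coefficient of `w` in `dch`"; and [Brown2012, §2.4, last display]: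
`per(Iᵐ(a₀; a₁,…,a_n; a_{n+1})) = ∫_{a₀}^{a_{n+1}} ω_{a₁} ⋯ ω_{a_n}`, `ω₀ = dt/t`, `ω₁ = dt/(1-t)`,
"a shuffle-regularized iterated integral (e.g. [DG] 5.16)", the signs being chosen so that
`per(ζᵐ(n₁,…,n_r)) = ζ(n₁,…,n_r)` for `n_r ≥ 2` ((2.19)).

This file realises `dch` in the tree and uses it to put the last field of the Deligne–Goncharov
input bundle `Brown2012.MotivicGaloisData` (`period`) in the form in which a theory of mixed Tate
motives delivers it.

* `Brown2012.dch w` — the shuffle-regularised iterated integral `∫₀¹ ω_{a₁} ⋯ ω_{a_n}` of the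
  binary word `w = a₁ ⋯ a_n` (`false = 0`, `true = 1`; Brown integrates over
  `0 < t₁ < ⋯ < t_n < 1`, the letter `a₁` nearest `0`). The tree evaluates iterated integrals on
  the DEcreasing simplex `1 > t₁ > ⋯ > t_n > 0` (`KZ.mzvRep_value_eq`, `MZV.binaryWord`,
  `MZV.zetaWordSum`), so Brown's word is the tree's word REVERSED, and the shuffle regularisation
  with respect to the tangential base points (`∫₀¹ ω₀ = ∫₀¹ ω₁ = 0`) is IKZ's two-sided `reg_ш`
  (`MZV.shuffleReg`, `reg(x) = reg(y) = 0`, a `ш`-homomorphism onto the convergent words):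
  `dch w := Z(reg_ш(w̃))`. In terms of the tree's Drinfeld associator (Furusho's normalisation,
  `du/(u-1) = -ω₁`): `dch w = (-1)^{#₁(w)} c_{w̃}(Φ_KZ)` (`dch_eq_drinfeldAssociator`).
* `dch` is a real point of `₀Π₁`, i.e. a character of the shuffle algebra `𝒪(₀Π₁)`
  (`dch_nil`, `dch_mul`, `isGroupLike_dch`; from Drinfeld's theorem
  `drinfeldAssociator_isGroupLike_holds`, proved in the tree from IKZ's regularisation theorem),
  `dch(e₀) = dch(e₁) = 0`, and on Brown's convergent words `dch(ρ(n₁,…,n_r)) = ζ(n₁,…,n_r)`,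
  i.e. `dch (rho s.reverse) = multipleZeta s` for the tree's (decreasing) admissible indices `s`
  (`dch_rho`, Kontsevich's formula in the form `drinfeldAssociator_binaryWord`);
  `dch(e₁e₀) = ζ(2)`, `dch(e₀e₁) = -ζ(2)`.
* `MotivicGaloisData.ofComparison`, `motivicMZV_nonempty_of_comparison`: in the constructor
  `MotivicGaloisData.ofCoalgebraMap` the hypothesis `period` (an identity on admissible indices
  only, mentioning `multipleZeta`) is replaced by Brown's (2.12) at the real point `dch` itself,
  `dch = g τ(√t₀).γ`, i.e. `⟨w, g τ(√t₀) γ⟩ = dch(w)` for EVERY word `w`: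
  `comparison : ∀ w, perLin g t₀ (Ψ ρ γ w) = dch w`
  ([Brown2012, §2.3: "we obtain an isomorphism `G'_𝒰 × 𝔸¹ ≅ 𝒴`, `(g,t) ↦ g τ(√t).γ`", applied to
  the real point `dch ∈ 𝒴(ℝ)`; [DeligneGoncharov2005, 5.16, 5.20]). The identification of the
  coefficients of `dch` with multiple zeta values is thereby taken out of the motivic input: it is
  the theorem `dch_rho` of the tree.

After this file the unproved input of `Brown2012.motivicMZV_nonempty` reads: a graded shuffle
character `ρ : 𝒪(₀Π₁) → 𝒰'` intertwining Goncharov's coproduct with deconcatenation, an even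
rational point `γ` of `₀Π₁`, and a real point `(g, t₀)` of `G'_𝒰 × 𝔸¹` with `g τ(√t₀).γ = dch` —
a statement about the Drinfeld associator alone ([Brown2012, §2.1–2.3]; [DeligneGoncharov2005,
§5]). No named fact is introduced.

## References

* F. Brown, *Mixed Tate motives over ℤ*, Ann. of Math. 175 (2012), 949–976, §2.1 (2.2), §2.3
  (2.12)–(2.13) (`(g,t) ↦ g τ(√t).γ`), §2.4 (period formula, (2.19)); arXiv:1102.1312. [Brown2012]
* P. Deligne, A. B. Goncharov, *Groupes fondamentaux motiviques de Tate mixte*, Ann. Sci. ÉNS 38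
  (2005), 1–56, 5.16, 5.20. [DeligneGoncharov2005]
* H. Furusho, Publ. RIMS 39 (2003), Prop. 3.2.3 (coefficients of `Φ_KZ`). [Furusho2003]
* K. Ihara, M. Kaneko, D. Zagier, Compos. Math. 142 (2006), §3, Cor. 5 (`reg_ш`).
  [IharaKanekoZagier2006]
-/

noncomputable section

open scoped BigOperators

namespace Literature.NumberTheory.Transcendental

namespace Brown2012

open MZV ShuffleMonoidAlgebra
open GoncharovFormalIteratedIntegrals (splittings)

/-! ## Brown's `dch : 𝒪(₀Π₁) → ℝ` -/

/-- **Brown's period point** `dch : 𝒪(₀Π₁) → ℝ`, `w ↦` the coefficient of `w` in the de Rham image of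
the straight path from `0` to `1` = the shuffle-regularised iterated integral
`∫_{0 < t₁ < ⋯ < t_n < 1} ω_{a₁}(t₁) ⋯ ω_{a_n}(t_n)` of `w = a₁⋯a_n` (`ω₀ = dt/t`, `ω₁ = dt/(1-t)`,
regularised by `∫₀¹ ω₀ = ∫₀¹ ω₁ = 0`). Realised through the tree's conventions, which read
iterated integrals from `1` down to `0`: `dch w = Z(reg_ш w̃)` with `w̃` the reversed word,
`reg_ш = MZV.shuffleReg` (IKZ) and `Z = MZV.zetaWordSum` (Kontsevich's evaluation of convergent
words by `multipleZeta`). [cite: Brown2012, §2.1 (2.2) and §2.4 (period formula)] -/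
def dch (w : List Bool) : ℝ := zetaWordSum (shuffleReg w.reverse)

/-- Unfolding `dch`. [cite: Brown2012, §2.1 (2.2)] -/
theorem dch_apply (w : List Bool) : dch w = zetaWordSum (shuffleReg w.reverse) := rfl

/-- `(-1)^n (-1)^n = 1` in `ℝ`. [folklore] -/
theorem neg_one_pow_mul_self (n : ℕ) : (-1 : ℝ) ^ n * (-1 : ℝ) ^ n = 1 := by
  rw [← mul_pow]; norm_num

/-- **`dch` and the Drinfeld associator**: `dch(w) = (-1)^{#₁(w)} c_{w̃}(Φ_KZ)` — Furusho's `Φ_KZ`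
integrates `du/(u-1) = -ω₁`, whence one sign per letter `1`, and the tree's words are Brown's
reversed ("dch … is also known as the Drinfeld associator").
[cite: Brown2012, §2.1 (2.2); Furusho2003, Prop. 3.2.3] -/
theorem dch_eq_drinfeldAssociator (w : List Bool) :
    dch w = (-1 : ℝ) ^ (w.count true) * drinfeldAssociator w.reverse := by
  rw [drinfeldAssociator_apply, List.count_reverse, ← mul_assoc, neg_one_pow_mul_self, one_mul,
    dch_apply]

/-- `⟨∅, dch⟩ = 1`: `dch` has constant term `1`. [cite: Brown2012, §2.1 (2.2)] -/
@[simp] theorem dch_nil : dch [] = 1 := by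
  rw [dch_eq_drinfeldAssociator, List.reverse_nil, drinfeldAssociator_nil]
  simp

/-- `dch(e₀) = ∫₀¹ dt/t = 0` (tangential regularisation at `0`). [cite: Brown2012, §2.4 (period
formula); DeligneGoncharov2005, 5.16] -/
@[simp] theorem dch_false : dch [false] = 0 := by
  rw [dch_eq_drinfeldAssociator, List.reverse_singleton, drinfeldAssociator_X₀, mul_zero]

/-- `dch(e₁) = ∫₀¹ dt/(1-t) = 0` (tangential regularisation at `1`). [cite: Brown2012, §2.4;
DeligneGoncharov2005, 5.16] -/
@[simp] theorem dch_true : dch [true] = 0 := by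
  rw [dch_eq_drinfeldAssociator, List.reverse_singleton, drinfeldAssociator_X₁, mul_zero]

/-- `dch(e₁e₀) = Iᵐ(0;10;1) = ζ(2)` (a convergent word: `per ζᵐ(2) = ζ(2)`, (2.19)).
[cite: Brown2012, §2.4 (2.19)] -/
theorem dch_true_false : dch [true, false] = multipleZeta [2] := by
  rw [dch_eq_drinfeldAssociator]
  simp [drinfeldAssociator_X₀X₁]

/-- `dch(e₀e₁) = -ζ(2)` (a regularised value: `0 = dch(e₀) dch(e₁) = dch(e₀e₁) + dch(e₁e₀)`).
[cite: Brown2012, §2.4 (period formula, shuffle regularisation)] -/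
theorem dch_false_true : dch [false, true] = -multipleZeta [2] := by
  rw [dch_eq_drinfeldAssociator]
  simp [drinfeldAssociator_X₁X₀]

/-- Shuffles preserve letter counts: `#ₐ(w) = #ₐ(u) + #ₐ(v)` for `w ∈ u ш v`. [folklore] -/
theorem count_eq_of_mem_shuffleWord (a : Bool) :
    ∀ (u v : List Bool) {w : List Bool}, w ∈ shuffleWord u v → w.count a = u.count a + v.count a
  | [], v, w, hw => by simp at hw; subst hw; simp
  | c :: u, [], w, hw => by simp at hw; subst hw; simp
  | c :: u, d :: v, w, hw => by
    rw [shuffleWord_cons_cons, List.mem_append, List.mem_map, List.mem_map] at hw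
    rcases hw with ⟨w', hw', rfl⟩ | ⟨w', hw', rfl⟩
    · have ih := count_eq_of_mem_shuffleWord a u (d :: v) hw'
      simp only [List.count_cons] at ih ⊢
      omega
    · have ih := count_eq_of_mem_shuffleWord a (c :: u) v hw'
      simp only [List.count_cons] at ih ⊢
      omega

/-- The unsigned regularised values `W ↦ Z(reg_ш W)` satisfy the shuffle relations (Drinfeld's
theorem "`Φ_KZ` is group-like" with the signs `(-1)^{#₁}` removed, these being multiplicative on
shuffles). [cite: IharaKanekoZagier2006, §3 (reg_ш is a ш-homomorphism); Furusho2003, Prop. 3.2.3] -/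
theorem zetaWordSum_shuffleReg_mul (u v : List Bool) :
    zetaWordSum (shuffleReg u) * zetaWordSum (shuffleReg v) =
      ((shuffleWord u v).map fun w => zetaWordSum (shuffleReg w)).sum := by
  have h := drinfeldAssociator_isGroupLike_holds.2 u v
  have key : zetaWordSum (shuffleReg u) * zetaWordSum (shuffleReg v) =
      (-1 : ℝ) ^ (u.count true) * (-1 : ℝ) ^ (v.count true) *
        (drinfeldAssociator u * drinfeldAssociator v) := by
    rw [drinfeldAssociator_apply, drinfeldAssociator_apply]
    calc zetaWordSum (shuffleReg u) * zetaWordSum (shuffleReg v)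
        = ((-1 : ℝ) ^ (u.count true) * (-1 : ℝ) ^ (u.count true)) * zetaWordSum (shuffleReg u) *
            (((-1 : ℝ) ^ (v.count true) * (-1 : ℝ) ^ (v.count true)) *
              zetaWordSum (shuffleReg v)) := by
          rw [neg_one_pow_mul_self, neg_one_pow_mul_self, one_mul, one_mul]
      _ = _ := by ring
  rw [key, h, ← List.sum_map_mul_left]
  refine congrArg List.sum (List.map_congr_left fun w hw => ?_)
  rw [drinfeldAssociator_apply, count_eq_of_mem_shuffleWord true u v hw, pow_add]
  calc (-1 : ℝ) ^ (u.count true) * (-1 : ℝ) ^ (v.count true) *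
        ((-1 : ℝ) ^ (u.count true) * (-1 : ℝ) ^ (v.count true) * zetaWordSum (shuffleReg w))
      = ((-1 : ℝ) ^ (u.count true) * (-1 : ℝ) ^ (u.count true)) *
          ((-1 : ℝ) ^ (v.count true) * (-1 : ℝ) ^ (v.count true)) *
            zetaWordSum (shuffleReg w) := by ring
    _ = zetaWordSum (shuffleReg w) := by
          rw [neg_one_pow_mul_self, neg_one_pow_mul_self, one_mul, one_mul]

/-- **`dch` is a point of `₀Π₁`**: a character of the shuffle algebra `𝒪(₀Π₁)` ((2.1)),
`dch(u) dch(v) = Σ_{w ∈ u ш v} dch(w)` — the regularised shuffle relations of multiple zeta values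
(reversal of words is an automorphism of `ш`). [cite: Brown2012, §2.1 (2.1)–(2.2);
DeligneGoncharov2005, 5.16] -/
theorem dch_mul (u v : List Bool) : dch u * dch v = ((shuffleWord u v).map dch).sum := by
  rw [dch_apply, dch_apply, zetaWordSum_shuffleReg_mul,
    ((shuffleWord_reverse_perm u v).map fun w => zetaWordSum (shuffleReg w)).sum_eq, List.map_map]
  rfl

/-- `dch ∈ ₀Π₁(ℝ)` is a group-like series. [cite: Brown2012, §2.1 (2.2)] -/
theorem isGroupLike_dch : NCSeries.IsGroupLike (show NCSeries Bool ℝ from dch) :=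
  ⟨dch_nil, dch_mul⟩

/-- Brown's word of an index reversed is the tree's binary word of the reversed index:
`ρ(s̃)~ = binaryWord s` (`ρ(n) = 1 0^{n-1}`, `binaryWord` puts `0^{n-1} 1`).
[cite: Brown2012, Definition 5.2 and (1.2)] -/
theorem reverse_rho_reverse (s : List ℕ) : (rho s.reverse).reverse = binaryWord s := by
  induction s with
  | nil => rfl
  | cons a s ih =>
    rw [List.reverse_cons, rho_append, List.reverse_append, ih, rho_cons, rho_nil,
      List.append_nil, rhoLetter, List.reverse_cons, List.reverse_replicate, binaryWord]

/-- **The coefficients of `dch` on convergent words are the multiple zeta values** ((2.19) with the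
period formula of §2.4: `dch(1 0^{n₁-1} ⋯ 1 0^{n_r-1}) = ζ(n₁,…,n_r)` for `n_r ≥ 2`, Brown summing
over `0 < k₁ < ⋯ < k_r`; the tree's `multipleZeta` sums in the opposite order, whence
`s.reverse`, exactly as in `MotivicMZV.per_J`) — Kontsevich's formula.
[cite: Brown2012, §2.4 (2.19); Furusho2003, Prop. 3.2.3] -/
theorem dch_rho {s : List ℕ} (hs : IsAdmissible s) : dch (rho s.reverse) = multipleZeta s := by
  have hconv : IsConvergentWord (binaryWord s) := by
    cases s with
    | nil => exact Or.inl rfl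
    | cons a s =>
      exact Or.inr ⟨head?_binaryWord (hs.2 (List.cons_ne_nil a s)),
        getLast?_binaryWord (List.cons_ne_nil a s)⟩
  rw [dch_apply, reverse_rho_reverse, shuffleReg_of_isConvergentWord hconv, zetaWordSum_single,
    ofBinaryWord_binaryWord hs.1]
  simp

/-! ## The comparison form of the period hypothesis -/

namespace MotivicGaloisData

/-- **The bundle from a coalgebra map and the comparison `dch = g τ(√t₀).γ`** ([Brown2012, §2.3
(2.12) at the real point `dch ∈ 𝒴(ℝ)`; [DeligneGoncharov2005, 5.16, 5.18–5.20]): as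
`ofCoalgebraMap`, with the hypothesis `period` replaced by the identity of real points of `₀Π₁`
`⟨w, g τ(√t₀) γ⟩ = dch(w)` for all words `w`; the values of `dch` on convergent words being the
multiple zeta values is the theorem `dch_rho`.
[cite: Brown2012, §2.1 (2.2), §2.3 (2.12), §2.4 (2.19); DeligneGoncharov2005, 5.13–5.16, 5.20] -/
def ofComparison (ρ : List Bool → UAlg) (ρ_nil : ρ [] = 1)
    (ρ_mul : ∀ u v : List Bool, ρ u * ρ v = ((shuffleWord u v).map ρ).sum)
    (ρ_mem : ∀ w : List Bool, ρ w ∈ uPrime w.length)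
    (ρ_coalg : ∀ w : List Bool, decHom (ρ w) =
      ((splittings w).map fun sp => leftEmb (galoisFactor ρ false sp.1 sp.2 true) *
        algebraMap UAlg UU (ρ (kept sp.2))).sum)
    (γ : List Bool → ℚ) (γ_nil : γ [] = 1)
    (γ_mul : ∀ u v : List Bool, γ u * γ v = ((shuffleWord u v).map γ).sum)
    (γ_odd : ∀ w : List Bool, Odd w.length → γ w = 0)
    (g : List ℕ → ℝ) (g_nil : g [] = 1)
    (g_mul : ∀ a b : List ℕ, g a * g b = ((shuffleWord a b).map g).sum) (t₀ : ℝ)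
    (comparison : ∀ w : List Bool, perLin g t₀ (Ψ ρ γ w) = dch w) : MotivicGaloisData :=
  ofCoalgebraMap ρ ρ_nil ρ_mul ρ_mem ρ_coalg γ γ_nil γ_mul γ_odd g g_nil g_mul t₀
    fun _ hs => (comparison _).trans (dch_rho hs)

/-- The constructor does not change `ρ`. [folklore] -/
@[simp] theorem ofComparison_ρ (ρ : List Bool → UAlg) (ρ_nil ρ_mul ρ_mem ρ_coalg)
    (γ : List Bool → ℚ) (γ_nil γ_mul γ_odd) (g : List ℕ → ℝ) (g_nil g_mul) (t₀ : ℝ)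
    (comparison) :
    (ofComparison ρ ρ_nil ρ_mul ρ_mem ρ_coalg γ γ_nil γ_mul γ_odd g g_nil g_mul t₀
      comparison).ρ = ρ :=
  rfl

end MotivicGaloisData

/-- **Brown's package from the comparison `dch = g τ(√t₀).γ`**: a graded shuffle character
`ρ : 𝒪(₀Π₁) → 𝒰'` intertwining Goncharov's coproduct with deconcatenation ((2.5)–(2.6),
Theorem 2.4; [DeligneGoncharov2005, 5.12–5.15]), an even rational point `γ` (§2.3) and a real point
`(g, t₀)` of `G'_𝒰 × 𝔸¹` with `g τ(√t₀).γ = dch` (§2.3 (2.12); [DeligneGoncharov2005, 5.16, 5.20])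
yield an inhabitant of `MotivicMZV`. [cite: Brown2012, §§2.1–2.5, §3.1; DeligneGoncharov2005,
5.12–5.16, 5.20; Goncharov2005, Prop 2.2] -/
theorem motivicMZV_nonempty_of_comparison (ρ : List Bool → UAlg) (ρ_nil : ρ [] = 1)
    (ρ_mul : ∀ u v : List Bool, ρ u * ρ v = ((shuffleWord u v).map ρ).sum)
    (ρ_mem : ∀ w : List Bool, ρ w ∈ uPrime w.length)
    (ρ_coalg : ∀ w : List Bool, decHom (ρ w) =
      ((splittings w).map fun sp => leftEmb (galoisFactor ρ false sp.1 sp.2 true) *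
        algebraMap UAlg UU (ρ (kept sp.2))).sum)
    (γ : List Bool → ℚ) (γ_nil : γ [] = 1)
    (γ_mul : ∀ u v : List Bool, γ u * γ v = ((shuffleWord u v).map γ).sum)
    (γ_odd : ∀ w : List Bool, Odd w.length → γ w = 0)
    (g : List ℕ → ℝ) (g_nil : g [] = 1)
    (g_mul : ∀ a b : List ℕ, g a * g b = ((shuffleWord a b).map g).sum) (t₀ : ℝ)
    (comparison : ∀ w : List Bool, perLin g t₀ (Ψ ρ γ w) = dch w) :
    motivicMZV_nonempty :=
  ⟨(MotivicGaloisData.ofComparison ρ ρ_nil ρ_mul ρ_mem ρ_coalg γ γ_nil γ_mul γ_odd g g_nil g_mul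
    t₀ comparison).toMotivicMZV⟩

end Brown2012

end Literature.NumberTheory.Transcendental
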